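import Summits.NavierStokesRegularity.NavierStokesRegularity.Theses.PumpContinuation
import Summits.NavierStokesRegularity.NavierStokesRegularity.Theorems.PerpetualPumpEulerTypeIGlue
import Summits.NavierStokesRegularity.NavierStokesRegularity.Theorems.PerpetualPumpThesisUniqueness
import Literature.Analysis.FluidPDE.RusinSverakSingularTimeHolds
import Literature.Analysis.FluidPDE.NSLerayHopfSereginEnergyProofs
import Literature.Analysis.FluidPDE.LerayHopfClassicalContinuation
import Literature.Analysis.FluidPDE.LerayLocalRegularH1Proofs
import Literature.Analysis.FluidPDE.NSLerayExistenceR3Holds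
import Literature.Analysis.FluidPDE.NSCriticalClosureTao
import Literature.Analysis.FluidPDE.TaoClassGlobal
import Literature.Analysis.FluidPDE.WeakSolutionWeakContinuity
import Literature.Barriers.NavierStokesRegularity.AveragedTypeIBlowup

/-!
# Route PumpContinuation · support `MildBlowupClassical` (stmt-NavierStokesRegularity-18304) — PROOF

`MildBlowupClassical`: an `H¹⁰_df`-mild solution (Tao 2016, (1.5)/(1.15), `ν = 1`) of the true
Navier–Stokes form from a Schwartz divergence-free datum `u₀` on `[0, S)` admitting no mild extension
past `S` yields X5a — a maximal smooth solution with finite lifespan, Leray–Hopf from its rapidly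
decaying datum.

Proof (all ingredients are theorems of the tree):

1. `u₀` has **no global Kato (`C_t L³`-mild) solution**: a global Kato solution from a Schwartz datum
   carries Tao-class classical solutions on every closed slab (`C([0,T]; L³)` is a regularity class,
   `exists_isTaoSolutionOn_of_hasGlobalKatoSolution'`); on `[0, S + 1)` such a solution is Leray–Hopf,
   hence (the PROVED front end of `EulerTypeIGlue`: `stub_memH10`, `stub_continuity`,
   `stub_identityTests`, `stub_cubic`, `stub_testToH10`) an `H¹⁰_df`-mild solution of Tao's identity
   with datum `schwartzL2 u₀`, which by uniqueness of `H¹⁰_df`-mild solutions (`stub_uniqueness` at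
   the Euler datum, `AveragedTypeI.euler_form_eq`) agrees with `u` on `[0, S)` — a mild extension past `S`, excluded.
2. Hence (Lemarié-Rieusset Thm. 15.1 / Rusin–Šverák §4, `exists_singularPoint_katoMaximalTime` with
   the discharged `kato_local_holds`, `continuation_of_bounded_holds`, `farField_bound_holds`) the Kato
   maximal time `T = T_max(u₀)` is finite and positive and the maximal Kato solution `u_K` has a
   singular point `(T, x_*)`: `‖u_K‖_{L^∞(Q_r(T, x_*))} = ∞` for every `r > 0`.
3. Tao-class solutions from `u₀` exist on every `[0, Tₙ]`, `Tₙ ↑ T`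
   (`exists_isTaoSolutionOn_of_isKatoSolutionOn`), agree on overlaps (Prodi–Serrin) and glue to a
   classical solution `(w, p)` on `[0, T)` (`IsClassicalNSSolutionOn.exists_glue_Ico_right`), equal
   a.e. slice-wise to `u_K` (`kato_unique`).
4. Leray–Hopf on `[0, T]`: Leray's global weak solution `u_L` from `u₀` (`leray_existence_R3_holds`)
   agrees a.e. with `w` at every `t ∈ (0, T)` (Serrin weak–strong uniqueness), so `w`, completed at
   `t = T` by the slice `u_L T` (and at `t = 0` by `u₀`), is Leray–Hopf (`congr_ae_slices` and the
   time-zero update proved here).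
5. Maximality: a classical extension past `T` is continuous, hence bounded, on the compact closure of
   a cylinder `Q_r(T, x_*)`, where it represents `u_K` a.e. — against the singular point.

## References

* T. Tao, J. Amer. Math. Soc. 29 (2016), arXiv:1402.0290v3, §1.1 (1.5), (1.15). [Tao2016AveragedNS]
* P. G. Lemarié-Rieusset, *The Navier–Stokes problem in the 21st century*, Thm. 15.1, Prop. 12.3.
* W. Rusin, V. Šverák, J. Funct. Anal. 260 (2011) = arXiv:0911.0500, §4. [RusinSverak2011]
* T. Kato, Math. Z. 187 (1984), Thms. 1, 4. [Kato1984]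
-/

noncomputable section

open MeasureTheory Set Filter Topology FourierTransform Function
open scoped ENNReal NNReal RealInnerProductSpace SchwartzMap ContDiff

-- the nested summit namespace `…NavierStokesRegularity.NavierStokesRegularity…` is the tree's layout
-- (D-0017), so the duplicated-namespace linter must be silenced for every declaration below
set_option linter.dupNamespace false

namespace Summit.NavierStokesRegularity.NavierStokesRegularity.Theorems

open Literature.Analysis.FluidPDE Literature.Analysis.FluidPDE.Tao2016
open Literature.Analysis.FunctionSpaces (eFourierSobolevNorm)
open Literature.Analysis.FunctionSpaces.EuclideanSpace (complexify complexify_apply norm_complexify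
  continuous_complexify)

namespace PumpContinuationMildBlowupClassical

/-! ## Small helpers -/

/-- A Schwartz field decays rapidly with all derivatives (Fefferman's class (4)). [folklore] -/
theorem hasRapidSpatialDecay_schwartz (u₀ : 𝓢(EuclideanSpace ℝ (Fin 3), EuclideanSpace ℝ (Fin 3))) :
    HasRapidSpatialDecay (⇑u₀) := fun n K =>
  ⟨_, fun x =>
    SchwartzMap.one_add_le_sup_seminorm_apply (𝕜 := ℝ) (m := (K, n)) le_rfl le_rfl u₀ x⟩

/-- **A Leray–Hopf solution may be reset to its datum at `t = 0`** (unforced system, `T > 0`,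
`u₀ ∈ L²`): every clause of `IsLerayHopfOn` lives on `(0, T]` except `u 0 ∈ L²` and the energy
inequality from `0` at `t = 0`, both of which hold for the slice `u₀`. [folklore] -/
theorem isLerayHopfOn_update_zero {T ν : ℝ} {u₀ : EuclideanSpace ℝ (Fin 3) → EuclideanSpace ℝ (Fin 3)}
    {u : ℝ → EuclideanSpace ℝ (Fin 3) → EuclideanSpace ℝ (Fin 3)}
    (h : IsLerayHopfOn T ν 0 u₀ u) (hu₀ : MemLp u₀ 2 volume) :
    IsLerayHopfOn T ν 0 u₀ (update u 0 u₀) := by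
  have hne : ∀ {t : ℝ}, 0 < t → update u 0 u₀ t = u t := fun ht => update_of_ne ht.ne' _ _
  -- the weak formulation only sees `(0, T)`
  have hweak : IsWeakNSSolutionOn T ν 0 u₀ (update u 0 u₀) := by
    refine IsWeakNSSolutionOn.congr_ae_slice h.weak ?_
    filter_upwards [ae_restrict_mem measurableSet_Ioo] with t ht
    exact hne ht.1
  -- `L^∞(0, T; L²)`
  have hEB : ∃ C : ℝ≥0, ∀ᵐ t ∂(volume.restrict (Ioo 0 T)), eEnergy (update u 0 u₀ t) ≤ C := by
    obtain ⟨C, hC⟩ := h.energy_bound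
    refine ⟨C, ?_⟩
    filter_upwards [hC, ae_restrict_mem measurableSet_Ioo] with t ht htI
    rwa [hne htI.1]
  -- slices in `L²`
  have hmem : ∀ t ∈ Icc 0 T, MemLp (update u 0 u₀ t) 2 volume := by
    intro t ht
    rcases ht.1.eq_or_lt with h0 | ht0
    · rw [← h0, update_self]; exact hu₀
    · rw [hne ht0]; exact h.memLp t ht
  -- weak gradient and the energy inequalities
  have hWG : ∃ G : ℝ → EuclideanSpace ℝ (Fin 3) →
      EuclideanSpace ℝ (Fin 3) →L[ℝ] EuclideanSpace ℝ (Fin 3),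
      (∀ᵐ t ∂(volume.restrict (Ioo 0 T)), HasWeakGradient (update u 0 u₀ t) (G t)) ∧
      (∫⁻ t in Ioo 0 T, ∫⁻ x, ENNReal.ofReal (frobeniusNormSq (G t x)) < (⊤ : ℝ≥0∞)) ∧
      (∀ t ∈ Icc 0 T, VectorCalculus.kineticEnergy (update u 0 u₀ t) +
        ν * (∫⁻ τ in Ioo 0 t, ∫⁻ x, ENNReal.ofReal (frobeniusNormSq (G τ x))).toReal ≤
        VectorCalculus.kineticEnergy u₀ +
          ∫ τ in (0 : ℝ)..t, ∫ x,
            ⟪(0 : ℝ → EuclideanSpace ℝ (Fin 3) → EuclideanSpace ℝ (Fin 3)) τ x, update u 0 u₀ τ x⟫) ∧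
      (∀ᵐ s ∂(volume.restrict (Ioo 0 T)), ∀ t ∈ Icc s T,
        VectorCalculus.kineticEnergy (update u 0 u₀ t) +
          ν * (∫⁻ τ in Ioo s t, ∫⁻ x, ENNReal.ofReal (frobeniusNormSq (G τ x))).toReal ≤
        VectorCalculus.kineticEnergy (update u 0 u₀ s) +
          ∫ τ in s..t, ∫ x,
            ⟪(0 : ℝ → EuclideanSpace ℝ (Fin 3) → EuclideanSpace ℝ (Fin 3)) τ x, update u 0 u₀ τ x⟫) := by
    obtain ⟨G, hG, hGint, h0, hae⟩ := h.weakGrad_energy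
    refine ⟨G, ?_, hGint, fun t ht => ?_, ?_⟩
    · filter_upwards [hG, ae_restrict_mem measurableSet_Ioo] with t ht htI
      rwa [hne htI.1]
    · rcases ht.1.eq_or_lt with h00 | ht0
      · subst h00
        simp only [update_self, Ioo_self, Measure.restrict_empty, lintegral_zero_measure,
          ENNReal.toReal_zero, mul_zero, add_zero, intervalIntegral.integral_same, le_refl]
      · have h1 := h0 t ht
        simp only [Pi.zero_apply, inner_zero_left, integral_zero, intervalIntegral.integral_zero,
          add_zero] at h1 ⊢
        rwa [hne ht0]
    · filter_upwards [hae, ae_restrict_mem measurableSet_Ioo] with s hs hsI t hst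
      have h1 := hs t hst
      simp only [Pi.zero_apply, inner_zero_left, integral_zero, intervalIntegral.integral_zero,
        add_zero] at h1 ⊢
      rwa [hne (hsI.1.trans_le hst.1), hne hsI.1]
  -- weak `L²` continuity and the weak initial limit
  have hWC : ∀ w : EuclideanSpace ℝ (Fin 3) → EuclideanSpace ℝ (Fin 3), MemLp w 2 volume →
      ContinuousOn (fun t => ∫ x, ⟪update u 0 u₀ t x, w x⟫) (Ioc 0 T) ∧
        Tendsto (fun t => ∫ x, ⟪update u 0 u₀ t x, w x⟫) (𝓝[>] 0) (𝓝 (∫ x, ⟪u₀ x, w x⟫)) := by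
    intro w hw
    obtain ⟨hcont, hlim⟩ := h.weak_continuous w hw
    refine ⟨hcont.congr fun t ht => by simp only [hne ht.1], hlim.congr' ?_⟩
    filter_upwards [self_mem_nhdsWithin] with t ht
    simp only [hne (show 0 < t from ht)]
  -- strong attainment of the datum
  have hSI : Tendsto (fun t => eLpNorm (update u 0 u₀ t - u₀) 2 volume) (𝓝[>] 0) (𝓝 0) := by
    refine h.strong_initial.congr' ?_
    filter_upwards [self_mem_nhdsWithin] with t ht
    simp only [hne (show 0 < t from ht)]
  exact ⟨hweak, hEB, hmem, hWG, hWC, hSI⟩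

/-- **Classical Leray–Hopf solutions from a Schwartz datum are `H¹⁰_df`-mild (Tao (1.5), `ν = 1`).**
The complexified curve `U t = [(u t)^ℂ]` of a classical solution on `[0, T)`, Leray–Hopf from the
Schwartz datum `u₀ = u 0`, is an `H¹⁰_df`-mild solution of Tao's identity for the Euler form with
datum `schwartzL2 u₀` — the proved front end of `EulerTypeIGlue` (`stub_memH10`, `stub_continuity`,
`stub_identityTests`, `stub_cubic`, `stub_testToH10`) at unit viscosity.
[cite: Tao2016AveragedNS, §1.1 (1.5), (1.15)] -/
theorem exists_isMildSolutionFor_of_classical {T : ℝ} (hT : 0 < T)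
    (u₀ : 𝓢(EuclideanSpace ℝ (Fin 3), EuclideanSpace ℝ (Fin 3)))
    {u : ℝ → EuclideanSpace ℝ (Fin 3) → EuclideanSpace ℝ (Fin 3)} {p : ℝ → EuclideanSpace ℝ (Fin 3) → ℝ}
    (hcl : IsClassicalNSSolutionOn (Ico 0 T) 1 0 u p)
    (hLH : IsLerayHopfOn T 1 0 (⇑u₀) u) (hu0 : u 0 = ⇑u₀) :
    ∃ U : ℝ → L2C, IsMildSolutionFor eulerForm (schwartzL2 u₀) (Ico 0 T) U ∧
      ∀ t ∈ Ico 0 T,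
        ((U t : L2C) : EuclideanSpace ℝ (Fin 3) → EuclideanSpace ℂ (Fin 3)) =ᵐ[volume] complexify ∘ u t := by
  have hLH' : IsLerayHopfOn T 1 0 (u 0) u := by rwa [hu0]
  have hdec : HasRapidSpatialDecay (u 0) := hu0 ▸ hasRapidSpatialDecay_schwartz u₀
  have h2 : ∀ t ∈ Ico 0 T, MemLp (complexify ∘ u t) 2 (volume : Measure (EuclideanSpace ℝ (Fin 3))) :=
    fun t ht =>
    PerpetualPumpEulerTypeIGlue.memLp_complexify_of_memLp (hLH.memLp t ⟨ht.1, ht.2.le⟩)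
  classical
  let U : ℝ → L2C := fun t => if ht : t ∈ Ico 0 T then (h2 t ht).toLp _ else 0
  have hU_eq : ∀ t (ht : t ∈ Ico 0 T), U t = (h2 t ht).toLp _ := fun t ht => by
    simp only [U, dif_pos ht]
  have hU : ∀ t ∈ Ico 0 T,
      ((U t : L2C) : EuclideanSpace ℝ (Fin 3) → EuclideanSpace ℂ (Fin 3)) =ᵐ[volume] complexify ∘ u t :=
      fun t ht => by
    rw [hU_eq t ht]
    exact (h2 t ht).coeFn_toLp
  have h0T : (0 : ℝ) ∈ Ico 0 T := ⟨le_rfl, hT⟩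
  have hH : ∀ t ∈ Ico 0 T, MemH10df (U t) :=
    PerpetualPumpEulerTypeIGlue.stub_memH10 one_pos hcl hLH' hdec U hU
  have hc : ContinuousInH10On (Ico 0 T) U :=
    PerpetualPumpEulerTypeIGlue.stub_continuity one_pos hT hcl hLH' hdec U hU
  have hid := PerpetualPumpEulerTypeIGlue.stub_testToH10 U hH hc
    (PerpetualPumpEulerTypeIGlue.stub_identityTests one_pos hT hcl hLH' hdec U hU hH
      (fun hf h2 hH hdf hψ hψ1 hψ' hψ2 =>
        PerpetualPumpEulerTypeIGlue.stub_cubic hf h2 hH hdf hψ hψ1 hψ' hψ2))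
  have hU0 : U 0 = schwartzL2 u₀ := by
    rw [hU_eq 0 h0T]
    exact MemLp.toLp_congr _ _ (Eventually.of_forall fun x => by rw [hu0])
  refine ⟨U, ⟨hH, hc, fun t ht w hw => ?_⟩, hU⟩
  have h := hid t ht w hw
  simp only [one_mul] at h
  rwa [hU0] at h

/-- **Bounded fields are in the Serrin class `L^∞_t L^∞_x`**, for a Tao-class solution. [folklore] -/
theorem memLqLp_top_top_of_isTaoSolutionOn {T : ℝ} {a : EuclideanSpace ℝ (Fin 3) → EuclideanSpace ℝ (Fin 3)}
    {v : ℝ → EuclideanSpace ℝ (Fin 3) → EuclideanSpace ℝ (Fin 3)} {q : ℝ → EuclideanSpace ℝ (Fin 3) → ℝ}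
    (hv : IsTaoSolutionOn T 1 a v q) : MemLqLp ⊤ ⊤ v (Ioo 0 T) := by
  obtain ⟨B, hB0, hB⟩ := hv.exists_bound_velocity
  exact memLqLp_top_top_of_forall_norm_le measurableSet_Ioo hB0
    (fun t ht => (hv.classical.contDiff_velocity ⟨ht.1.le, ht.2.le⟩).continuous)
    fun t ht x => hB t ⟨ht.1.le, ht.2.le⟩ x

end PumpContinuationMildBlowupClassical

open PumpContinuationMildBlowupClassical in
/-- **`MildBlowupClassical` (stmt-NavierStokesRegularity-18304) holds**: an `H¹⁰_df`-mild solution of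
the Navier–Stokes form (Tao (1.5), `ν = 1`) from a Schwartz divergence-free datum with no mild
extension past `S` yields a maximal smooth solution with finite lifespan, Leray–Hopf from its rapidly
decaying datum (X5a). The lifespan is the Kato maximal time `T_max(u₀)`, finite because a global Kato
solution would be classical (von Wahl / Lemarié-Rieusset Prop. 12.3), hence `H¹⁰_df`-mild past `S`
(front end of `EulerTypeIGlue` + uniqueness of `H¹⁰_df`-mild solutions); the solution is the glued
family of Tao-class solutions below `T_max`, Leray–Hopf by comparison with Leray's weak solution, and
maximal because of the singular point at `T_max` (Lemarié-Rieusset Thm. 15.1 / Rusin–Šverák §4).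
[cite: Tao2016AveragedNS, §1.1 (1.5), (1.15)] -/
theorem pumpContinuation_mildBlowupClassical_proof : Theses.PumpContinuation.MildBlowupClassical := by
  intro u₀ hdiv S hS u hu hnoext
  classical
  -- the datum
  have hsm : ContDiff ℝ ∞ (⇑u₀) := u₀.smooth ⊤
  have hdec : HasRapidSpatialDecay (⇑u₀) := hasRapidSpatialDecay_schwartz u₀
  have hdivW : NSWave0.IsDivFree (⇑u₀) := fun x => hdiv x
  have h2 : MemLp (⇑u₀) 2 (volume : Measure (EuclideanSpace ℝ (Fin 3))) := u₀.memLp 2 _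
  have h3 : MemLp (⇑u₀) 3 (volume : Measure (EuclideanSpace ℝ (Fin 3))) := u₀.memLp 3 _
  have hwdiv : IsWeaklyDivFree (⇑u₀) :=
    VectorCalculus.IsDivFree.isWeaklyDivFree_holds hdiv (hsm.of_le (mod_cast le_top))
  /- Step 1: `u₀` has no global Kato solution (else a mild extension of `u` past `S`). -/
  have hng : ¬ HasGlobalKatoSolution 1 (⇑u₀) := by
    intro hK
    have hS1 : 0 < S + 1 := by linarith
    obtain ⟨v, q, hv⟩ :=
      exists_isTaoSolutionOn_of_hasGlobalKatoSolution' one_pos hsm hdivW hdec hK hS1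
    have hcl : IsClassicalNSSolutionOn (Ico 0 (S + 1)) 1 0 v q :=
      hv.classical.mono Ico_subset_Icc_self (uniqueDiffOn_Ico 0 (S + 1))
    obtain ⟨V, hV, -⟩ :=
      exists_isMildSolutionFor_of_classical hS1 u₀ hcl (hv.isLerayHopfOn hS1) hv.initial
    refine hnoext ⟨S + 1, by linarith, V, hV, fun t ht => ?_⟩
    have hV' : IsMildSolutionFor AveragingDatum.euler.form (schwartzL2 u₀) (Ico 0 S) V := by
      rw [Literature.Barriers.NavierStokesRegularity.AveragedTypeI.euler_form_eq]
      exact hV.mono (Ico_subset_Ico_right (by linarith))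
    have hu' : IsMildSolutionFor AveragingDatum.euler.form (schwartzL2 u₀) (Ico 0 S) u := by
      rw [Literature.Barriers.NavierStokesRegularity.AveragedTypeI.euler_form_eq]
      exact hu
    exact PerpetualPumpThesis.stub_uniqueness AveragingDatum.euler (schwartzL2 u₀) S V u hV' hu' t
      ht
  /- Step 2: the maximal Kato solution `uK` on `[0, T)`, `T = T_max(u₀) < ∞`, and its singular
  point. -/
  obtain ⟨hpos, htop, xs, uK, huK, hsing⟩ := exists_singularPoint_katoMaximalTime kato_local_holds
    IsKatoSolutionOn.continuation_of_bounded_holds IsKatoSolutionOn.farField_bound_holds one_pos h3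
    hwdiv hng
  set T : ℝ := (katoMaximalTime 1 (⇑u₀)).toReal with hTdef
  have hT : 0 < T := ENNReal.toReal_pos hpos.ne' htop.ne
  /- Step 3: Tao-class solutions on `[0, b n]`, `b n ↑ T`, glued to a classical solution on
  `[0, T)`. -/
  set b : ℕ → ℝ := fun n => T - T / ((n : ℝ) + 2) with hbdef
  have hb_pos : ∀ n, 0 < b n := fun n => by
    have hn2 : (2 : ℝ) ≤ (n : ℝ) + 2 := by have := n.cast_nonneg (α := ℝ); linarith
    have h1 : T / ((n : ℝ) + 2) ≤ T / 2 := div_le_div_of_nonneg_left hT.le (by norm_num) hn2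
    show 0 < T - T / ((n : ℝ) + 2)
    linarith
  have hb_lt : ∀ n, b n < T := fun n => by
    have : 0 < T / ((n : ℝ) + 2) := by positivity
    show T - T / ((n : ℝ) + 2) < T
    linarith
  have hcof : ∀ t, t < T → ∃ n, t < b n := by
    intro t ht
    obtain ⟨n, hn⟩ := exists_nat_gt (T / (T - t))
    refine ⟨n, ?_⟩
    have hpos' : 0 < T - t := sub_pos.2 ht
    rw [div_lt_iff₀ hpos'] at hn
    have h1 : T < ((n : ℝ) + 2) * (T - t) := by nlinarith
    have h2 : T / ((n : ℝ) + 2) < T - t := by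
      rw [div_lt_iff₀ (by positivity)]
      linarith [mul_comm (T - t) ((n : ℝ) + 2)]
    show t < T - T / ((n : ℝ) + 2)
    linarith
  have hex : ∀ n, ∃ (U : ℝ → EuclideanSpace ℝ (Fin 3) → EuclideanSpace ℝ (Fin 3))
      (P : ℝ → EuclideanSpace ℝ (Fin 3) → ℝ), IsTaoSolutionOn (b n) 1 (⇑u₀) U P := fun n =>
    exists_isTaoSolutionOn_of_isKatoSolutionOn one_pos hsm hdivW hdec huK (hb_pos n) (hb_lt n)
  choose U P hUP using hex
  have hagree : ∀ m n, ∀ t ∈ Ico 0 (min (b m) (b n)), U m t = U n t := fun m n =>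
    (hUP m).eq_of_isTaoSolutionOn (hUP n) one_pos (hb_pos m) (hb_pos n)
  obtain ⟨w, p, hwcl, hwU⟩ := IsClassicalNSSolutionOn.exists_glue_Ico_right (a := 0) (β := T)
    (fun n => (hb_lt n).le) hcof
    (fun n => (hUP n).classical.mono Ico_subset_Icc_self (uniqueDiffOn_Ico 0 (b n))) hagree
  -- `w` attains the datum and agrees a.e. slicewise with the Kato solution
  have hw0 : w 0 = ⇑u₀ := by
    rw [hwU 0 0 ⟨le_rfl, hb_pos 0⟩]; exact (hUP 0).initial
  have hwK : ∀ t ∈ Ico 0 T, w t =ᵐ[volume] uK t := by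
    intro t ht
    obtain ⟨n, hn⟩ := hcof t ht.2
    have hKn := huK.mono (hb_lt n).le
    rw [hwU n t ⟨ht.1, hn⟩]
    exact (hUP n).ae_eq_of_kato one_pos hKn.mild hKn.continuousInLpOn hKn.aestronglyMeasurable t
      ⟨ht.1, hn⟩
  have hwmeas : AEStronglyMeasurable (uncurry w) (volume.restrict (Ioo 0 T ×ˢ univ)) :=
    (hwcl.smooth_velocity.continuousOn.mono
      (prod_mono Ioo_subset_Ico_self Subset.rfl)).aestronglyMeasurable
        (measurableSet_Ioo.prod MeasurableSet.univ)
  /- Step 4: Leray–Hopf on `[0, T]` by comparison with Leray's global weak solution. -/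
  obtain ⟨uL, huL⟩ := leray_existence_R3_holds 1 one_pos (⇑u₀) h2 hwdiv
  have hLw : ∀ t ∈ Ioo 0 T, w t =ᵐ[volume] uL t := by
    intro t ht
    obtain ⟨n, hn⟩ := hcof t ht.2
    have hae := serrin_weak_strong_uniqueness_holds one_pos (hb_pos n)
      ((hUP n).isLerayHopfOn (hb_pos n)) h2 (q := ⊤) (r := ⊤) (by simp) (by simp)
      (memLqLp_top_top_of_isTaoSolutionOn (hUP n)) (huL (b n) (hb_pos n)) t ⟨ht.1, hn.le⟩
    rw [hwU n t ⟨ht.1.le, hn⟩]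
    exact hae.symm
  -- the completed velocity: `w` on `[0, T)`, Leray's slice at `t = T`
  set v₁ : ℝ → EuclideanSpace ℝ (Fin 3) → EuclideanSpace ℝ (Fin 3) :=
    fun t => if t ∈ Ioo 0 T then w t else uL t with hv₁_def
  set wf : ℝ → EuclideanSpace ℝ (Fin 3) → EuclideanSpace ℝ (Fin 3) := update v₁ 0 (⇑u₀)
    with hwf_def
  have hwf0 : wf 0 = ⇑u₀ := by rw [hwf_def, update_self]
  have hwf : ∀ t ∈ Ico 0 T, wf t = w t := by
    intro t ht
    rcases ht.1.eq_or_lt with h0 | ht0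
    · rw [← h0, hwf0, hw0]
    · rw [hwf_def, update_of_ne ht0.ne', show v₁ t = w t from if_pos ⟨ht0, ht.2⟩]
  have hv₁meas : AEStronglyMeasurable (uncurry v₁) (volume.restrict (Ioo 0 T ×ˢ univ)) := by
    refine hwmeas.congr ?_
    filter_upwards [ae_restrict_mem (measurableSet_Ioo.prod MeasurableSet.univ)] with z hz
    show w z.1 z.2 = v₁ z.1 z.2
    rw [show v₁ z.1 = w z.1 from if_pos hz.1]
  have hLH₁ : IsLerayHopfOn T 1 0 (⇑u₀) v₁ := by
    refine (huL T hT).congr_ae_slices hT hv₁meas fun t ht => ?_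
    by_cases htI : t ∈ Ioo 0 T
    · rw [show v₁ t = w t from if_pos htI]
      exact hLw t htI
    · rw [show v₁ t = uL t from if_neg htI]
  have hLH : IsLerayHopfOn T 1 0 (⇑u₀) wf := by
    rw [hwf_def]
    exact isLerayHopfOn_update_zero hLH₁ h2
  have hwfcl : IsClassicalNSSolutionOn (Ico 0 T) 1 0 wf p := hwcl.congr_slices hwf fun _ _ => rfl
  /- Step 5: maximality from the singular point `(T, xs)`. -/
  have hmax : ¬ HasSmoothExtensionPast 1 0 wf T := by
    rintro ⟨T', hTT', u', p', hcl', hagree'⟩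
    -- a backward cylinder inside the strip `(0, T) × (EuclideanSpace ℝ (Fin 3))`
    set r : ℝ := min 1 (T / 2) with hr
    have hr0 : 0 < r := lt_min one_pos (by linarith)
    have hrT : r ^ 2 < T := by
      have h1 : r ≤ 1 := min_le_left _ _
      have h2 : r ≤ T / 2 := min_le_right _ _
      nlinarith
    -- the extension is bounded on the compact closure of the cylinder
    have hK : IsCompact (Icc (T - r ^ 2) T ×ˢ Metric.closedBall xs r) :=
      isCompact_Icc.prod (isCompact_closedBall _ _)
    have hKsub : Icc (T - r ^ 2) T ×ˢ Metric.closedBall xs r ⊆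
        Ico 0 T' ×ˢ (univ : Set (EuclideanSpace ℝ (Fin 3))) :=
      prod_mono (fun t ht => ⟨by linarith [ht.1, sq_nonneg r], ht.2.trans_lt hTT'⟩) (subset_univ _)
    obtain ⟨M, hM⟩ :=
      hK.exists_bound_of_continuousOn (hcl'.smooth_velocity.continuousOn.mono hKsub)
    -- `uK = w = u'` a.e. on the cylinder
    have haeK : uncurry uK =ᵐ[volume.restrict (Ioo 0 T ×ˢ univ)] uncurry w :=
      ae_restrict_prod_of_forall_ae_eq (fun t ht => (hwK t ⟨ht.1.le, ht.2⟩).symm)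
        huK.aestronglyMeasurable hwmeas
    have hQsub :
        parabolicCylinder r (T, xs) ⊆ Ioo 0 T ×ˢ (univ : Set (EuclideanSpace ℝ (Fin 3))) := by
      intro z hz
      simp only [mem_parabolicCylinder] at hz
      exact ⟨⟨by linarith [hz.1.1], hz.1.2⟩, mem_univ _⟩
    have hQmeas : MeasurableSet (parabolicCylinder r ((T, xs) : ℝ × EuclideanSpace ℝ (Fin 3))) :=
      measurableSet_Ioo.prod Metric.isOpen_ball.measurableSet
    have hbd : ∀ᵐ z ∂(volume.restrict (parabolicCylinder r (T, xs))), ‖uncurry uK z‖ ≤ M := by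
      filter_upwards [ae_restrict_of_ae_restrict_of_subset hQsub haeK, ae_restrict_mem hQmeas]
        with z hz hzQ
      simp only [mem_parabolicCylinder] at hzQ
      have hzT : z.1 ∈ Ico 0 T := ⟨by linarith [hzQ.1.1], hzQ.1.2⟩
      rw [hz, show uncurry w z = u' z.1 z.2 by
        show w z.1 z.2 = u' z.1 z.2
        rw [hagree' z.1 hzT, hwf z.1 hzT]]
      exact hM z ⟨⟨hzQ.1.1.le, hzQ.1.2.le⟩, Metric.mem_closedBall.2 hzQ.2.le⟩
    have hfin : eLpNorm (uncurry uK) ⊤ (volume.restrict (parabolicCylinder r (T, xs))) < ⊤ := by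
      rw [eLpNorm_exponent_top]
      exact eLpNormEssSup_lt_top_of_ae_bound hbd
    exact hfin.ne (hsing r hr0)
  refine ⟨T, hT, wf, p, ⟨hwfcl, hmax⟩, ?_, ?_⟩
  · rw [hwf0]; exact hLH
  · rw [hwf0]; exact hdec

end Summit.NavierStokesRegularity.NavierStokesRegularity.Theorems

end
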